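import Mathlib
/-!
# U-RECV (g23) — arithmetic plate for the unipotent receiver letters on bd78f9c7

TOKEN `line stmt-HodgeConjecture-18881 Cruxes/BlochSeedDiscOne/Lines/birth.lean 814a6a70c14e831a stub_rung_pad4_seedAt`
Evidence-only bookkeeping (Mathlib-only, no project imports): the closed-form numbers quoted in
`g23/memo/U-RECV-unipotent1-g23.md`. Nothing here is a statement about the Hodge conjecture,
HC_CM, HC_AV, №4, 26512, 18881 or H2; the stub named in the token is untouched.
-/

namespace HsemiregUnipotent1.G23

/-- corner top loss of a two-factor receiver `arc_M ⊗ arc_M'` (per copy):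
`dim B/(𝔪₁𝔪₂)B = M M' − (M−1)(M'−1) = M + M' − 1`. -/
theorem corner_top_loss (M M' : ℕ) (hM : 1 ≤ M) (hM' : 1 ≤ M') :
    M * M' - (M - 1) * (M' - 1) = M + M' - 1 := by
  obtain ⟨a, rfl⟩ := Nat.exists_eq_add_of_le hM
  obtain ⟨b, rfl⟩ := Nat.exists_eq_add_of_le hM'
  simp; ring_nf; omega

/-- the three receiver classes of bd78f9c7: exact balanced splits of the cell masses. -/
theorem split_207644 : 244 * 851 = 207644 ∧ 244 + 851 - 1 = 1094 := by norm_num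
theorem split_52542 : 189 * 278 = 52542 ∧ 189 + 278 - 1 = 466 := by norm_num
theorem split_19829 : 79 * 251 = 19829 ∧ 19829 - (19829 - 1) = 1 := by norm_num

/-- LEMMA T, row ¬a ∧ b (LINE source, receiver adapted to the killed direction): the block keeps
`gen_H = M − 1` of the `M` target dimensions on the kill divisor; for the hub block into a
207 644-receiver on a codim-2 cross stratum this is `(244−1)(851−1) = 206 550` per copy, versus `0`
for a LINE receiver. -/
theorem hub_block_on_corner_stratum : (244 - 1) * (851 - 1) = 206550 ∧ 207644 - 206550 = 1094 := by
  norm_num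

/-- codim-2 root budget. The 44 root×root free pairs fail KJ by at most `16 133` at `ρ₁ = 704 039`
(g22's codim-1 minimum); the deficit is shared by the two roots of the pair, so the minimal ROOT arc
length clearing them at `s = 1` is `ρ₂ = ρ₁ + 8 067 = 712 106` (bisection: `712 105` fails by exactly 1,
`2·8 067 − 1 = 16 133`). The design of record uses `ρ = 720 173 ≥ ρ₂`; both fit a₁'s rank budget
`1 780 509·s − 3·176 695·s`, with LINE remainders `538 318·s` resp. `530 251·s`. -/
theorem root_budget : 704039 + 8067 = 712106 ∧ 2 * 8067 - 1 = 16133 ∧ 712106 ≤ 720173 ∧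
    1780509 - 3 * 176695 - 712106 = 538318 ∧ 1780509 - 3 * 176695 - 720173 = 530251 ∧
    3 * 176695 + 720173 ≤ 1780509 := by norm_num

/-- (V3) bookkeeping: on a hub-exit cross stratum the 12 starving 207 644-receivers fed through the two
killed hub factors regain `12 · 206 550 = 2 478 600 ≥ 103 258` (the record KQ deficit). -/
theorem v3_restored_supply : 12 * 206550 = 2478600 ∧ 103258 ≤ 2478600 := by norm_num

end HsemiregUnipotent1.G23
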